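import Mathlib
import Summits.PneNP.PneNP.Theorems.OneSliceSliceTargetSplitTransport

/-!
# Route OneSlice, crux `MonotoneContinuation` (stmt-PneNP-18471) — vocabulary of the line `ProfileLine`

Objects posited by the lead's skeleton of the crux `OneSlice.MonotoneContinuation`
(`Cruxes/MonotoneContinuation/Lines/Sketch_ideator1_r1.lean`), shared by the skeleton and the stub files:

* `profile f i` — the acceptance PROFILE of a Boolean function `f` on the edge cube: the fraction of the
  Hamming slice `i` it accepts (for monotone `f`, the CDF of the ignition time of `f` along the random graph
  process);
* `binW N p r = C(N,r) p^r (1-p)^{N-r}` — binomial weights;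
* `meet y ρ`, `join y ρ` — pointwise `∧` / `∨` of edge vectors (restriction of `y` to `ρ`, padding of `y` by `ρ`);
* `delSampler q f`, `padSampler q f` — the fixed-rate DELETION / PADDING samplers
  `y ↦ E_ρ 𝟙[f](y ∧ ρ)` (`ρ ∼ G(n,1-q)`) and `y ↦ E_ρ 𝟙[f](y ∨ ρ)` (`ρ ∼ G(n,q)`), written as finite sums;
* `majVote gs` — the majority vote of `t` Boolean functions.

Only definitions and their unfolding lemmas live here (D-0016: route-posited objects in a `…Defs` file).
Lead prover-line-stmt-PneNP-18471-0, 2026-08-17.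
-/

set_option linter.dupNamespace false -- `Summit.PneNP.PneNP.…`: summit = sub-problem (D-0017)

namespace Summit.PneNP.PneNP.Theorems.MonotoneContinuation

open Literature.Computability.Complexity hiding supp mem_supp
open Finset hiding slice
open Classical
open Summit.PneNP.PneNP.Theorems.ConstantBand.Negative (Edge slice)
open Summit.PneNP.PneNP.Theorems.SliceTargetSplit (ind)

noncomputable section

variable {n : ℕ}

/-- The acceptance PROFILE of a Boolean function on the edge cube of `K_n`: the fraction of the Hamming slice `i`
it accepts (`0` on an empty slice). [folklore] -/
def profile (f : (Edge n → Bool) → Bool) (i : ℕ) : ℝ := (∑ x ∈ slice n i, ind f x) / #(slice n i)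

/-- The binomial weight `C(N,r) p^r (1-p)^{N-r}`. [folklore] -/
def binW (N : ℕ) (p : ℝ) (r : ℕ) : ℝ := (N.choose r : ℝ) * p ^ r * (1 - p) ^ (N - r)

/-- Pointwise meet of two edge vectors: `y` restricted to the edges of `ρ`. [folklore] -/
def meet (y ρ : Edge n → Bool) : Edge n → Bool := fun e => y e && ρ e

/-- Pointwise join of two edge vectors: `y` padded by the edges of `ρ`. [folklore] -/
def join (y ρ : Edge n → Bool) : Edge n → Bool := fun e => y e || ρ e

/-- The DELETION sampler of `f` at deletion rate `q`: `y ↦ E_ρ 𝟙[f](y ∧ ρ)` with `ρ ∼ G(n, 1-q)`, i.e. every edge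
of `y` is deleted independently with probability `q`. [folklore] -/
def delSampler (q : ℝ) (f : (Edge n → Bool) → Bool) (y : Edge n → Bool) : ℝ :=
  ∑ ρ, gnpWeight n (1 - q) ρ * ind f (meet y ρ)

/-- The PADDING sampler of `f` at padding rate `q`: `y ↦ E_ρ 𝟙[f](y ∨ ρ)` with `ρ ∼ G(n, q)`, i.e. every absent edge
is added independently with probability `q`. [folklore] -/
def padSampler (q : ℝ) (f : (Edge n → Bool) → Bool) (y : Edge n → Bool) : ℝ :=
  ∑ ρ, gnpWeight n q ρ * ind f (join y ρ)

/-- Majority vote of `t` Boolean functions: `true` iff more than half of them accept. [folklore] -/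
def majVote {t : ℕ} (gs : Fin t → (Edge n → Bool) → Bool) (y : Edge n → Bool) : Bool :=
  decide (t < 2 * #(univ.filter fun a : Fin t => gs a y = true))

/-! ### Unfolding lemmas -/

section ProfileDef

variable (f : (Edge n → Bool) → Bool) (i : ℕ)

/-- Unfolding `profile` (registered sub-goal `profile_def` of stmt-PneNP-18471, which lets this vocabulary file ride
`--supports`). [folklore] -/
theorem profile_def : profile f i = (∑ x ∈ slice n i, ind f x) / #(slice n i) := rfl

end ProfileDef

/-- Unfolding `binW`. [folklore] -/
theorem binW_def (N : ℕ) (p : ℝ) (r : ℕ) : binW N p r = (N.choose r : ℝ) * p ^ r * (1 - p) ^ (N - r) := rfl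

/-- Unfolding `meet`. [folklore] -/
@[simp] theorem meet_apply (y ρ : Edge n → Bool) (e : Edge n) : meet y ρ e = (y e && ρ e) := rfl

/-- Unfolding `join`. [folklore] -/
@[simp] theorem join_apply (y ρ : Edge n → Bool) (e : Edge n) : join y ρ e = (y e || ρ e) := rfl

/-- Unfolding `delSampler`. [folklore] -/
theorem delSampler_def (q : ℝ) (f : (Edge n → Bool) → Bool) (y : Edge n → Bool) :
    delSampler q f y = ∑ ρ, gnpWeight n (1 - q) ρ * ind f (meet y ρ) := rfl

/-- Unfolding `padSampler`. [folklore] -/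
theorem padSampler_def (q : ℝ) (f : (Edge n → Bool) → Bool) (y : Edge n → Bool) :
    padSampler q f y = ∑ ρ, gnpWeight n q ρ * ind f (join y ρ) := rfl

/-- Unfolding `majVote`. [folklore] -/
theorem majVote_def {t : ℕ} (gs : Fin t → (Edge n → Bool) → Bool) (y : Edge n → Bool) :
    majVote gs y = decide (t < 2 * #(univ.filter fun a : Fin t => gs a y = true)) := rfl

/-- `meet` is monotone in its first argument. [folklore] -/
theorem meet_mono_left {y y' : Edge n → Bool} (h : y ≤ y') (ρ : Edge n → Bool) : meet y ρ ≤ meet y' ρ := by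
  intro e
  have := h e
  simp only [meet_apply]
  revert this
  cases y e <;> cases y' e <;> cases ρ e <;> simp

/-- `join` is monotone in its first argument. [folklore] -/
theorem join_mono_left {y y' : Edge n → Bool} (h : y ≤ y') (ρ : Edge n → Bool) : join y ρ ≤ join y' ρ := by
  intro e
  have := h e
  simp only [join_apply]
  revert this
  cases y e <;> cases y' e <;> cases ρ e <;> simp

/-! ## Vocabulary of the bridge `MC → flat-above` (uniform-size padding; lead, cycle 2)

The padding representative of the bridge pads a point `x` of slice `i` by a uniformly random `ρ` with `a` edges, the
size `a` itself uniform on a window `A`; the objects below are shared by the bridge files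
`…PadLanding`, `…PadVotes`, `…BridgeWindow`, `…BridgeStep`, `…FlatAbove`. -/

/-- The uniform-size padding law on the size window `A`: a size `a ∈ A` uniformly, then a uniformly random `ρ` with
`a` edges; `padLaw n A ρ = 1/(#A · #slice_{e(ρ)})` if `e(ρ) ∈ A` and `0` otherwise. [folklore] -/
def padLaw (n : ℕ) (A : Finset ℕ) (ρ : Edge n → Bool) : ℝ :=
  ∑ a ∈ A, if edgeCount ρ = a then 1 / ((#A : ℝ) * #(slice n a)) else 0

/-- The fibre coefficient of the regrouping by landing level: the number of `ρ` of size `a` padding a fixed `x` with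
`i` edges to a fixed superset with `i + l` edges, `C(i, a - l)` (`0` if `a < l`). [folklore] -/
def padCoef (i a l : ℕ) : ℝ := if l ≤ a then ((i.choose (a - l) : ℕ) : ℝ) else 0

/-- The landing weight of the offset `l`: the probability that `x ∨ ρ` has `i + l` edges when `x` is on slice `i` and
`ρ ∼ padLaw n A`, in the closed form produced by the regrouping `padMixture_expand`. [folklore] -/
def landW (n i : ℕ) (A : Finset ℕ) (l : ℕ) : ℝ :=
  (∑ a ∈ A, padCoef i a l / ((#A : ℝ) * #(slice n a))) * ((i + l).choose i : ℝ) * #(slice n (i + l)) / #(slice n i)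

/-- The smallest padding size of the bridge: `⌈(m + 3q - j) · N/(N - j)⌉`, so that padding slice `j` by `a₀` edges
lands, in the mean, `3q` above the threshold level `m` (`q = ⌊√m⌋`). [folklore] -/
def padBase (N m q j : ℕ) : ℕ := ⌈((m + 3 * q - j : ℕ) : ℝ) * N / ((N : ℝ) - j)⌉₊

/-- The size window of the bridge: `[a₀, a₀ + ⌊√m⌋]`. [folklore] -/
def padWindow (N m j : ℕ) : Finset ℕ :=
  Finset.Ico (padBase N m (Nat.sqrt m) j) (padBase N m (Nat.sqrt m) j + (Nat.sqrt m + 1))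

/-- The binomial lower-bound constant of the good window of half-width `(L+6)/2` (from `shellMass_pointwise`). [folklore] -/
def cbConst (L : ℕ) : ℝ := Real.exp (-(240 * (((L : ℝ) + 6) / 2) ^ 2)) * 3 / 32

/-- The two-slice test measure: half the uniform law of slice `j`, half that of slice `i`. [folklore] -/
def nuTwo (n j i : ℕ) (y : Edge n → Bool) : ℝ :=
  (if edgeCount y = j then 1 / (2 * (#(slice n j) : ℝ)) else 0) + (if edgeCount y = i then 1 / (2 * (#(slice n i) : ℝ)) else 0)

/-- Unfolding `padLaw`. [folklore] -/
theorem padLaw_def : ∀ (n : ℕ) (A : Finset ℕ) (ρ : Edge n → Bool),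
    padLaw n A ρ = ∑ a ∈ A, if edgeCount ρ = a then 1 / ((#A : ℝ) * #(slice n a)) else 0 := fun _ _ _ => rfl

/-- Unfolding `padCoef`. [folklore] -/
theorem padCoef_def (i a l : ℕ) : padCoef i a l = if l ≤ a then ((i.choose (a - l) : ℕ) : ℝ) else 0 := rfl

/-- Unfolding `landW`. [folklore] -/
theorem landW_def (n i : ℕ) (A : Finset ℕ) (l : ℕ) :
    landW n i A l = (∑ a ∈ A, padCoef i a l / ((#A : ℝ) * #(slice n a))) * ((i + l).choose i : ℝ) *
      #(slice n (i + l)) / #(slice n i) := rfl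

/-- Unfolding `padBase`. [folklore] -/
theorem padBase_def (N m q j : ℕ) : padBase N m q j = ⌈((m + 3 * q - j : ℕ) : ℝ) * N / ((N : ℝ) - j)⌉₊ := rfl

/-- Unfolding `padWindow`. [folklore] -/
theorem padWindow_def (N m j : ℕ) :
    padWindow N m j = Finset.Ico (padBase N m (Nat.sqrt m) j) (padBase N m (Nat.sqrt m) j + (Nat.sqrt m + 1)) := rfl

/-- Unfolding `cbConst`. [folklore] -/
theorem cbConst_def (L : ℕ) : cbConst L = Real.exp (-(240 * (((L : ℝ) + 6) / 2) ^ 2)) * 3 / 32 := rfl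

/-- Unfolding `nuTwo`. [folklore] -/
theorem nuTwo_def (n j i : ℕ) (y : Edge n → Bool) :
    nuTwo n j i y = (if edgeCount y = j then 1 / (2 * (#(slice n j) : ℝ)) else 0) +
      (if edgeCount y = i then 1 / (2 * (#(slice n i) : ℝ)) else 0) := rfl

/-! ## Vocabulary of the bridge `MC → flat-below` (uniform-size deletion; lead, cycle 2)

Mirror image of the padding vocabulary: a point `x` of slice `i` is deleted down to `x ∧ ¬ρ`, `ρ ∼ padLaw n A` (a uniformly
random `ρ` with a uniformly random size in the window `A`); shared by `…DelLanding`, `…DelVotes`, `…BridgeWindowDown`,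
`…BridgeStepDown`, `…FlatBelow`. -/

/-- The fibre coefficient of the regrouping by landing level for deletion: the number of `ρ` of size `a` deleting a fixed
`x` with `i` edges down to a fixed subset with `i - l` edges, `C(N - i, a - l)` (`0` if `a < l`). [folklore] -/
def delCoef (N i a l : ℕ) : ℝ := if l ≤ a then (((N - i).choose (a - l) : ℕ) : ℝ) else 0

/-- The landing weight of the offset `l` for deletion: the probability that `x ∧ ¬ρ` has `i - l` edges when `x` is on slice
`i` and `ρ ∼ padLaw n A`, in the closed form produced by `delMixture_expand`. [folklore] -/
def landWD (n i : ℕ) (A : Finset ℕ) (l : ℕ) : ℝ :=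
  (∑ a ∈ A, delCoef (n.choose 2) i a l / ((#A : ℝ) * #(slice n a))) * ((n.choose 2 - (i - l)).choose l : ℝ) *
    #(slice n (i - l)) / #(slice n i)

/-- The nominal smallest deleted size of the bridge: `⌈(j - m + 3q) · N/j⌉`, so that deleting `a₀` uniformly random slots
from slice `j` lands, in the mean, `3q` below the threshold level `m` (`q = ⌊√m⌋`). [folklore] -/
def delBase (N m q j : ℕ) : ℕ := ⌈((j - m + 3 * q : ℕ) : ℝ) * N / (j : ℝ)⌉₊

/-- The number of deleted sizes in the window: `⌈q N/j⌉ + 1` (so that the mean landing level spreads over `q` levels). [folklore] -/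
def delWidth (N q j : ℕ) : ℕ := ⌈(q : ℝ) * N / (j : ℝ)⌉₊ + 1

/-- The deleted-size window of the bridge, as a `Finset`. [folklore] -/
def delWindowF (N m j : ℕ) : Finset ℕ :=
  Finset.Ico (delBase N m (Nat.sqrt m) j) (delBase N m (Nat.sqrt m) j + delWidth N (Nat.sqrt m) j)

/-- The binomial lower-bound constant of the good window of the deletion bridge (half-width `L + 3`). [folklore] -/
def cbConstD (L : ℕ) : ℝ := Real.exp (-(240 * ((L : ℝ) + 3) ^ 2)) * 3 / 32

/-- Unfolding `delCoef`. [folklore] -/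
theorem delCoef_def : ∀ (N i a l : ℕ), delCoef N i a l = if l ≤ a then (((N - i).choose (a - l) : ℕ) : ℝ) else 0 :=
  fun _ _ _ _ => rfl

/-- Unfolding `landWD`. [folklore] -/
theorem landWD_def (n i : ℕ) (A : Finset ℕ) (l : ℕ) :
    landWD n i A l = (∑ a ∈ A, delCoef (n.choose 2) i a l / ((#A : ℝ) * #(slice n a))) *
      ((n.choose 2 - (i - l)).choose l : ℝ) * #(slice n (i - l)) / #(slice n i) := rfl

/-- Unfolding `delBase`. [folklore] -/
theorem delBase_def (N m q j : ℕ) : delBase N m q j = ⌈((j - m + 3 * q : ℕ) : ℝ) * N / (j : ℝ)⌉₊ := rfl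

/-- Unfolding `delWidth`. [folklore] -/
theorem delWidth_def (N q j : ℕ) : delWidth N q j = ⌈(q : ℝ) * N / (j : ℝ)⌉₊ + 1 := rfl

/-- Unfolding `delWindowF`. [folklore] -/
theorem delWindowF_def (N m j : ℕ) :
    delWindowF N m j = Finset.Ico (delBase N m (Nat.sqrt m) j) (delBase N m (Nat.sqrt m) j + delWidth N (Nat.sqrt m) j) := rfl

/-- Unfolding `cbConstD`. [folklore] -/
theorem cbConstD_def (L : ℕ) : cbConstD L = Real.exp (-(240 * ((L : ℝ) + 3) ^ 2)) * 3 / 32 := rfl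

end

end Summit.PneNP.PneNP.Theorems.MonotoneContinuation
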